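import Summits.Langlands.Langlands.Theorems.IrreducibilityBySelfDualityPairLBoundaryJSSpreadPairDatumOfInitialDatum
import Summits.Langlands.Langlands.Theorems.IrreducibilityBySelfDualityPairLBoundaryJSArchLevelWeightFixingPair
import Summits.Langlands.Langlands.Theorems.IrreducibilityBySelfDualityPairLBoundaryJSInitialVectorTranslateNeZero
import Summits.Langlands.Langlands.Theorems.IrreducibilityBySelfDualityPairLBoundaryJSUnitBoxTranslateProductForm
import Summits.Langlands.Langlands.Theorems.IrreducibilityBySelfDualityPairLBoundaryJSUnitBoxTranslateAvg
import Summits.Langlands.Langlands.Theorems.IrreducibilityBySelfDualityPairLBoundaryJSTranslateArchValue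
import Summits.Langlands.Langlands.Theorems.IrreducibilityBySelfDualityPairLBoundaryJSWhittakerCoeffSmoothedFormProps
import Literature.NumberTheory.Automorphic.ArchRankinSelbergPairBridge

/-!
# Crux `PairLBoundaryJS` (stmt-Langlands-13622), line `Sketch` — stub `stub_local_single_datum` (M1):
# ONE archimedean Rankin–Selberg datum realised inside the translated thin box integral

Summit `Langlands`, sub-problem `Langlands`, helper file under `Theorems/` supporting the crux
`PairLBoundaryJS` (Arthur–Clozel (1989), Ch. 3, (2.2)), line `Sketch`, registered stub
`stub_local_single_datum`.

This is the per-datum core of the local Rankin–Selberg theory of a cuspidal pair `(P, Q)` on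
`GL_{n+1}(𝔸_K)` in translate form (Jacquet–Piatetski-Shapiro–Shalika (1983), (2.7) at the finite
places of `S₀`, by spread/thin data; Cogdell (2004), §4.1, `Ψ = ∏_v Ψ_v` for factorizable data):
given a torus element `D = diag τ` (last entry `1`, trivial at `S₀ ∪ ∞`, integral off a finite `S₁₀`
disjoint from `S₀`), pure tensors `S₁ ∈ π_f`, `S₁' ∈ σ_f` of levels `K_f(𝔫P)`, `K_f(𝔫Q)` with
`𝔫P 𝔫Q` supported on `S₀`, and `K_∞`-finite Gårding vectors `e`, `e'` of the archimedean
components `τP`, `τQ`, there are a level `𝔫` supported on `S₀`, vectors `f ∈ P`, `f' ∈ Q`, ONE test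
function `η` of level `K(𝔫)`, a depth `m` and `κ > 0` with, for every continuous `Φ_∞` and every `s`,

  `∫_{B({v ∉ S₀}) × K} W_{S_η f}(D ·) W̄_{S_η f'}(D ·) (thinTestFun Φ_∞ S₀ m)(e ·) |det|^s δ⁻¹
      = κ · Ψ_∞(s; Φ_λ(D_f S₁), Φ_λ(D_f S₁'), e, e', Φ_∞)`.

Everything deep is a LANDED helper of the line; this file assembles:

* conjugation control `D_f⁻¹ K_f(𝔫P 𝔞) D_f ≤ K_f(𝔫P)` with `𝔞` supported on `S₁₀`
  (`InitialVectorTranslateNeZero.exists_forall_conj_mem_finitePrincipalCongruenceLevel`);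
* the initial pure tensors `f₁ = Ŝ₁ e`, `f₁' = Ŝ₁' e'`, fixed by `K(𝔫P 𝔫Q)` and `K_∞`-finite
  (`corestrictW_apply_apply`), and Harish-Chandra's product bump `β` for the pair at level
  `K_f(𝔫P 𝔫Q)` (`ArchLevelWeightFixingPair.stub_archLevelWeight_fixing_pair`);
* the spread datum `f = E_L f₁` with `T₀ := S₀` and partner level `𝔫P 𝔫Q`, so that `T = S₀`
  (`SpreadPairDatumOfInitialDatum.stub_spreadPairDatum_of_initialDatum`), the smoothing scalars
  `S_η f = a f` and `S_η f₁' = a' f₁'`, `a' = c_{K_f 𝔫} / c_{K_f(𝔫P 𝔫Q)}`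
  (`smoothedVector_archLevelWeight_eq_smul_archIntegral`);
* the abstract properties of `W = W_{S_η f}`, `W' = W_{S_η f₁'}`
  (`WhittakerCoeffSmoothedFormProps.stub_whittakerCoeff_smoothedForm_props`), the support collapse and
  product form on the unit box (`UnitBoxTranslateProductForm.stub_unitBox_translate_productForm`), the
  archimedean values `W(D (h, 1)) = a Φ_λ(D_f S₁)(τP(h) e)`, `W'(D (h, 1)) = a' Φ_λ(D_f S₁')(τQ(h) e')`
  (`TranslateArchValue.stub_translate_arch_value`, with `L` and with `L = []`), coset averaging
  (`UnitBoxTranslateAvg.stub_unitBox_translate_avg`) and `archRankinSelbergPairIntegral_def`;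
  `κ = r a a'`.

All proofs complete; tree theorems only.

## References

* H. Jacquet, I. I. Piatetski-Shapiro, J. A. Shalika, *Rankin–Selberg convolutions*, Amer. J. Math.
  105 (1983), §2, (2.7) [JacquetPiatetskiShapiroShalika1983].
* J. W. Cogdell, *Analytic theory of L-functions for GL_n*, in *An Introduction to the Langlands
  Program* (2004), §1.2, §2.3, §4.1 [CogdellAnalyticTheory2004].
-/

noncomputable section

-- `Summit.Langlands.Langlands.…` (summit = sub-problem name, D-0017 layout) trips `dupNamespace`
set_option linter.dupNamespace false

open scoped MatrixGroups Topology Pointwise ENNReal NNReal ComplexConjugate InnerProductSpace ContDiff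
-- the place subtypes indexing `mixedSpace K` are `Fintype` classically (`NormedCommRing (mixedSpace K)`)
open scoped Classical Matrix.Norms.Operator
open NumberField IsDedekindDomain MeasureTheory Measure Matrix Set Filter WithZero
open NumberField.mixedEmbedding
open Literature.NumberTheory.Automorphic AdelicGroupData
open Literature.NumberTheory.GaloisRepresentations (ideleGroup HeckeCharacter)
open ValuativeRel

-- the automorphic quotient carries the tree's Borel σ-algebra, not Mathlib's quotient σ-algebra
attribute [-instance] Quotient.instMeasurableSpace QuotientGroup.measurableSpace

-- the house local instances, exactly as in `RankinSelbergUnfoldingIdentity`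
attribute [local instance] adelicBorel borelSpace_adelic locallyCompactSpace_adelic secondCountableTopology_gl_adelic
  glAdeleBorel borelSpace_glAdele borelSpace_ideleGroup secondCountableTopology_ideleGroup

-- Mathlib idiom: the commutator Lie ring on matrices, to mention `(archGroupGL n K).lie`
attribute [local instance 100] LieRing.ofAssociativeRing

namespace Summit.Langlands.Langlands.Theorems.LocalSingleDatum

/-! ### Small glue lemmas -/

/-- **The prime factors of `∏_{v ∈ S} 𝔭_v^{k_v}` lie in `S`** (unique factorisation of ideals in the
Dedekind domain `𝓞 K`). [folklore] -/
theorem mem_of_dvd_prod_pow {K : Type} [Field K] [NumberField K] {S : Finset (HeightOneSpectrum (𝓞 K))}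
    (k : HeightOneSpectrum (𝓞 K) → ℕ) {w : HeightOneSpectrum (𝓞 K)}
    (hw : w.asIdeal ∣ ∏ v ∈ S, v.asIdeal ^ k v) : w ∈ S := by
  obtain ⟨v, hv, hdvd⟩ := w.prime.exists_mem_finset_dvd hw
  have h1 : w.asIdeal ∣ v.asIdeal := w.prime.dvd_of_dvd_pow hdvd
  have h2 : v.asIdeal = w.asIdeal := v.isMaximal.eq_of_le w.isPrime.ne_top (Ideal.le_of_dvd h1)
  rwa [HeightOneSpectrum.ext h2.symm]

/-- **A vector fixed by `(1, K_f(𝔫))` is fixed by `K(𝔫)`**: every element of `K(𝔫) ≤ K^max` is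
`(1, h)` with `h ∈ K_f(𝔫)` (`GLn.ofFinite_sndHom_of_mem`). [folklore] -/
theorem toContRep_eq_self_of_forall_ofFinite {n : ℕ} {K : Type} [Field K] [NumberField K]
    {μ : Measure (AdelicGroupData.gl n K).automorphicQuotient} [(AdelicGroupData.gl n K).IsAutomorphicMeasure μ]
    (W : ContRepresentation.ClosedSubrep ((AdelicGroupData.gl n K).rightRegular μ)) {𝔫 : Ideal (𝓞 K)}
    {x : W.toSubmodule}
    (hx : ∀ u ∈ finitePrincipalCongruenceLevel n K 𝔫, W.toContRep (GLn.ofFinite n K u) x = x) :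
    ∀ g ∈ principalCongruenceLevel n K 𝔫, W.toContRep g x = x := by
  intro g hg
  have h1 : GLn.ofFinite n K (GLn.sndHom n K g) = g :=
    GLn.ofFinite_sndHom_of_mem (principalCongruenceLevel_le n K 𝔫 hg)
  have h2 : GLn.sndHom n K g ∈ finitePrincipalCongruenceLevel n K 𝔫 := by
    rw [mem_finitePrincipalCongruenceLevel_iff, h1]; exact hg
  rw [← h1]
  exact hx _ h2

/-- **`K_∞`-finiteness passes through a `G_∞`-intertwiner**: the `K_∞`-orbit of the pure tensor
`T̂ e` is the image under the linear map `T̂` of the `K_∞`-orbit of `e` (`corestrictW_apply_apply`,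
`(AutomorphyDatum.gl n K hcpt).ofK k = (k, 1)`), so its span is finite-dimensional with that of `e`.
[folklore] -/
theorem finiteDimensional_span_corestrictW {n : ℕ} {K : Type} [Field K] [NumberField K]
    {μ : Measure (AdelicGroupData.gl n K).automorphicQuotient} [(AdelicGroupData.gl n K).IsAutomorphicMeasure μ]
    {hcpt : isCompact_glFiniteIntegralLevel n K}
    {E : Type} [NormedAddCommGroup E] [InnerProductSpace ℂ E]
    {τ : ContRepresentation ℂ (AutomorphyDatum.gl n K hcpt).arch.carrier E}
    {W : ContRepresentation.ClosedSubrep ((AdelicGroupData.gl n K).rightRegular μ)}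
    {T : E →L[ℂ] (AdelicGroupData.gl n K).L2 μ} (hT : T ∈ archIntertwiners hcpt τ W) (e : E)
    (hfin : FiniteDimensional ℂ (Submodule.span ℂ (Set.range
      fun κ : (AutomorphyDatum.gl n K hcpt).arch.maximalCompact => τ (toArch hcpt (κ : GL (Fin n) (mixedSpace K))) e))) :
    FiniteDimensional ℂ (Submodule.span ℂ (Set.range
      fun k : (AutomorphyDatum.gl n K hcpt).arch.maximalCompact => W.toContRep ((AutomorphyDatum.gl n K hcpt).ofK k) (corestrictW hT e))) := by
  have hrange : (Set.range fun k : (AutomorphyDatum.gl n K hcpt).arch.maximalCompact =>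
      W.toContRep ((AutomorphyDatum.gl n K hcpt).ofK k) (corestrictW hT e)) =
      ((corestrictW hT : E →L[ℂ] W.toSubmodule) : E →ₗ[ℂ] W.toSubmodule) ''
        Set.range (fun κ : (AutomorphyDatum.gl n K hcpt).arch.maximalCompact =>
          τ (toArch hcpt (κ : GL (Fin n) (mixedSpace K))) e) := by
    rw [← Set.range_comp]
    refine congrArg Set.range (funext fun k => ?_)
    rw [Function.comp_apply, ContinuousLinearMap.coe_coe, corestrictW_apply_apply, AutomorphyDatum.gl_ofK_apply]
  rw [hrange, ← Submodule.map_span]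
  infer_instance

/-! ### The registered stub -/

set_option maxHeartbeats 1600000 in
/-- **STUB (M1, engineering) — ONE archimedean Rankin–Selberg datum realised inside the translated thin box
integral.** Given cuspidal `P`, `Q` on `GL_{n+1}`, a finite `S₀`, a torus element `τ` with last entry `1`, trivial at
`S₀ ∪ ∞` and integral off a finite `S₁₀` disjoint from `S₀`, pure tensors `S₁ ∈ π_f`, `S₁' ∈ σ_f` of levels `K_f(𝔫P)`,
`K_f(𝔫Q)` with `𝔫P 𝔫Q` supported on `S₀` (`P ⟂ Q` or `P = Q` is carried for the Harish-Chandra stub and not used otherwise),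
and `K_∞`-finite Gårding vectors `e`, `e'`: there are a level `𝔫` supported on `S₀`, vectors `f ∈ P`, `f' ∈ Q`, ONE test
function `η` of level `K(𝔫)`, a depth `m` and `κ > 0` with, for every continuous `Φ_∞` and every `s`,
`∫_{B({v∉S₀})×K} W_{S_η f}(D ·) W̄_{S_η f'}(D ·) (thinTestFun Φ_∞ S₀ m)(e ·) |det|^s δ⁻¹ = κ · Ψ_∞(s; Φ_λ(D_f S₁), Φ_λ(D_f S₁'), e, e', Φ_∞)`,
`D = diag τ`. Assembly of LANDED stubs: conjugation control `D_f⁻¹ K_f(𝔫 𝔞) D_f ≤ K_f(𝔫)`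
(`InitialVectorTranslateNeZero.exists_forall_conj_mem_finitePrincipalCongruenceLevel S₁₀`), Harish-Chandra product bump
`β` for `(Ŝ₁ e, Ŝ₁' e')` at level `K_f(𝔫P 𝔫Q)` (`ArchLevelWeightFixingPair.stub_archLevelWeight_fixing_pair`), spread datum
`f = E_L (Ŝ₁ e)` (`SpreadPairDatumOfInitialDatum.stub_spreadPairDatum_of_initialDatum`, `T₀ := S₀`, partner level `𝔫P 𝔫Q`,
so `T = S₀`), `f' := Ŝ₁' e'` with smoothing scalar `a' = c_{K_f 𝔫} / c_{K_f(𝔫P 𝔫Q)}`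
(`smoothedVector_archLevelWeight_eq_smul_archIntegral`), the abstract properties of `W`, `W'`
(`WhittakerCoeffSmoothedFormProps.stub_whittakerCoeff_smoothedForm_props`), product form
(`UnitBoxTranslateProductForm.stub_unitBox_translate_productForm`), the archimedean values
(`TranslateArchValue.stub_translate_arch_value`, with `L` and with `L = []`), coset averaging
(`UnitBoxTranslateAvg.stub_unitBox_translate_avg`, `A := a Φ_λ(D_f S₁)(τ(·) e)`, `B := conj (a' Φ_λ(D_f S₁')(σ(·) e'))`),
`archRankinSelbergPairIntegral_def`, `κ := r a a'`.
[cite: CogdellAnalyticTheory2004, §4.1] [cite: JacquetPiatetskiShapiroShalika1983, §2 (2.7)] -/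
theorem stub_local_single_datum :
    ∀ {n : ℕ} {K : Type} [Field K] [NumberField K]
      {μ : Measure (AdelicGroupData.gl (n + 1) K).automorphicQuotient} [(AdelicGroupData.gl (n + 1) K).IsAutomorphicMeasure μ]
      [MeasurableSpace (AdeleRing (𝓞 K) K)] [BorelSpace (AdeleRing (𝓞 K) K)]
      (hcpt : isCompact_glFiniteIntegralLevel (n + 1) K) (P Q : CuspidalAutomorphicRepGL (n + 1) K μ)
      (νA : Measure (Fin (n + 1) → ideleGroup K)) [IsHaarMeasure νA]
      (νK : Measure ↥(maximalCompactAdelic (n + 1) K)) [IsHaarMeasure νK]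
      (ν₀ : Measure ↥(adelicUnipotent (n + 1) K)) [IsHaarMeasure ν₀]
      {E : Type} [NormedAddCommGroup E] [InnerProductSpace ℂ E] [CompleteSpace E]
      {τP : ContRepresentation ℂ (AutomorphyDatum.gl (n + 1) K hcpt).arch.carrier E} (hτPc : τP.IsStronglyContinuous)
      {E' : Type} [NormedAddCommGroup E'] [InnerProductSpace ℂ E'] [CompleteSpace E']
      {τQ : ContRepresentation ℂ (AutomorphyDatum.gl (n + 1) K hcpt).arch.carrier E'} (hτQc : τQ.IsStronglyContinuous)
      (S₀ S₁₀ : Finset (HeightOneSpectrum (𝓞 K))) (_ : Disjoint S₀ S₁₀) (τ : Fin (n + 1) → ideleGroup K),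
    let D : GL (Fin (n + 1)) (AdeleRing (𝓞 K) K) := glDiagonal (n + 1) (AdeleRing (𝓞 K) K) τ
    ∀ (_ : lastEntry τ = 1) (_ : GLn.toMixed (n + 1) K D = 1) (_ : ∀ v ∈ S₀, localComponent v D = 1)
      (_ : ∀ v ∉ S₁₀, localComponent v D ∈ glInt (n + 1) (v.adicCompletion K))
      {𝔫P 𝔫Q : Ideal (𝓞 K)} (_ : 𝔫P ≠ 0) (_ : 𝔫Q ≠ 0)
      (_ : ∀ w : HeightOneSpectrum (𝓞 K), w.asIdeal ∣ 𝔫P * 𝔫Q → w ∈ S₀) (_ : P.1.toSubmodule ⟂ Q.1.toSubmodule ∨ P = Q)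
      (S₁ : multiplicityModule hcpt τP P.1)
      (_ : (S₁ : E →L[ℂ] (AdelicGroupData.gl (n + 1) K).L2 μ) ∈ archIntertwinersLevel hcpt τP P.1 (finitePrincipalCongruenceLevel (n + 1) K 𝔫P))
      (S₁' : multiplicityModule hcpt τQ Q.1)
      (_ : (S₁' : E' →L[ℂ] (AdelicGroupData.gl (n + 1) K).L2 μ) ∈ archIntertwinersLevel hcpt τQ Q.1 (finitePrincipalCongruenceLevel (n + 1) K 𝔫Q))
      (e : archGardingSpace hcpt τP) (e' : archGardingSpace hcpt τQ)
      (_ : FiniteDimensional ℂ (Submodule.span ℂ (Set.range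
        fun κ : (AutomorphyDatum.gl (n + 1) K hcpt).arch.maximalCompact => τP (toArch hcpt (κ : GL (Fin (n + 1)) (mixedSpace K))) (e : E))))
      (_ : FiniteDimensional ℂ (Submodule.span ℂ (Set.range
        fun κ : (AutomorphyDatum.gl (n + 1) K hcpt).arch.maximalCompact => τQ (toArch hcpt (κ : GL (Fin (n + 1)) (mixedSpace K))) (e' : E'))))
      [MeasurableSpace (GL (Fin (n + 1)) (mixedSpace K))] [BorelSpace (GL (Fin (n + 1)) (mixedSpace K))],
    ∃ (𝔫 : Ideal (𝓞 K)) (_ : 𝔫 ≠ 0) (_ : ∀ w : HeightOneSpectrum (𝓞 K), w.asIdeal ∣ 𝔫 → w ∈ S₀)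
      (f : P.1.toSubmodule) (f' : Q.1.toSubmodule) (η : (AdelicGroupData.gl (n + 1) K).Adelic → ℝ) (_ : IsTestFunctionGL (n + 1) K η)
      (_ : ∀ k : (AdelicGroupData.gl (n + 1) K).Adelic, k ∈ principalCongruenceLevel (n + 1) K 𝔫 → ∀ g : (AdelicGroupData.gl (n + 1) K).Adelic, η (k * g) = η g)
      (m : ℕ) (κ : ℝ), 0 < κ ∧
      ∀ (Φinf : (Fin (n + 1) → InfiniteAdeleRing K) → ℝ), Continuous Φinf → ∀ s : ℂ,
        ∫ p in unitBox {v | v ∉ (↑S₀ : Set (HeightOneSpectrum (𝓞 K)))} ×ˢ Set.univ,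
          torusPairIntegrandC (n + 1) K
            (fun g => whittakerCoeff ν₀ (unipotentTateDomain (n + 1) K) (adeleAddChar K) (invQuot (AdelicGroupData.gl (n + 1) K) (smoothedForm η ((f : P.1.toSubmodule) : (AdelicGroupData.gl (n + 1) K).L2 μ))) (D * g))
            (fun g => star (whittakerCoeff ν₀ (unipotentTateDomain (n + 1) K) (adeleAddChar K) (invQuot (AdelicGroupData.gl (n + 1) K) (smoothedForm η ((f' : Q.1.toSubmodule) : (AdelicGroupData.gl (n + 1) K).L2 μ)))) (D * g))
            (thinTestFun (n + 1) K Φinf S₀ m) s p ∂(νA.prod νK) =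
        (κ : ℂ) * archRankinSelbergPairIntegral hcpt τP hτPc τQ hτQc
          (transferMap (whittakerFunctional ν₀ (continuous_adeleAddChar K) (ContRepresentation.Equiv.refl P.1.toContRep)) hτPc
            (finComponentRep hcpt τP P.1 (GLn.sndHom (n + 1) K D) S₁))
          (transferMap (whittakerFunctional ν₀ (continuous_adeleAddChar K) (ContRepresentation.Equiv.refl Q.1.toContRep)) hτQc
            (finComponentRep hcpt τQ Q.1 (GLn.sndHom (n + 1) K D) S₁')) e e' Φinf
          (((νA.restrict (unitBox (Set.univ : Set (HeightOneSpectrum (𝓞 K))))).map (archTorusOfIdele (n + 1) K)))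
          (νK.map (kinfOfMaximalCompact (n + 1) K)) s := by
  intro n K _ _ μ _ _ _ hcpt P Q νA _ νK _ ν₀ _ E _ _ _ τP hτPc E' _ _ _ τQ hτQc S₀ S₁₀ hdisj τ D hlast hDinf hDS₀ hDint
    𝔫P 𝔫Q h𝔫P h𝔫Q hsupp hPQ S₁ hS₁ S₁' hS₁' e e' hefin he'fin _ _
  have hne : 𝔫P * 𝔫Q ≠ 0 := mul_ne_zero h𝔫P h𝔫Q
  /- (0) conjugation control: `D_f⁻¹ K_f(𝔫P 𝔞P) D_f ≤ K_f(𝔫P)`, `D_f⁻¹ K_f(𝔫Q 𝔞Q) D_f ≤ K_f(𝔫Q)` with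
  `𝔞P`, `𝔞Q` supported on `S₁₀` -/
  obtain ⟨kP, -, hconjP⟩ :=
    InitialVectorTranslateNeZero.exists_forall_conj_mem_finitePrincipalCongruenceLevel S₁₀ h𝔫P hDint
  obtain ⟨kQ, -, hconjQ⟩ :=
    InitialVectorTranslateNeZero.exists_forall_conj_mem_finitePrincipalCongruenceLevel S₁₀ h𝔫Q hDint
  have h𝔞P : (∏ v ∈ S₁₀, v.asIdeal ^ kP v : Ideal (𝓞 K)) ≠ 0 :=
    Finset.prod_ne_zero_iff.2 fun v _ => pow_ne_zero _ v.ne_bot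
  have h𝔞Q : (∏ v ∈ S₁₀, v.asIdeal ^ kQ v : Ideal (𝓞 K)) ≠ 0 :=
    Finset.prod_ne_zero_iff.2 fun v _ => pow_ne_zero _ v.ne_bot
  /- (1) the initial pure tensors `f₁ = Ŝ₁ e`, `f₁' = Ŝ₁' e'`: level `K(𝔫P 𝔫Q)` and `K_∞`-finiteness -/
  set f₁ : P.1.toSubmodule := corestrictW (mem_archIntertwiners_of_mem_multiplicityModule S₁.2) (e : E)
  set f₁' : Q.1.toSubmodule := corestrictW (mem_archIntertwiners_of_mem_multiplicityModule S₁'.2) (e' : E')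
  have hKP : finitePrincipalCongruenceLevel (n + 1) K (𝔫P * 𝔫Q) ≤ finitePrincipalCongruenceLevel (n + 1) K 𝔫P :=
    fun u hu => mem_finitePrincipalCongruenceLevel_iff.2
      (principalCongruenceLevel_mono (n + 1) K hne Ideal.mul_le_right (mem_finitePrincipalCongruenceLevel_iff.1 hu))
  have hKQ : finitePrincipalCongruenceLevel (n + 1) K (𝔫P * 𝔫Q) ≤ finitePrincipalCongruenceLevel (n + 1) K 𝔫Q :=
    fun u hu => mem_finitePrincipalCongruenceLevel_iff.2
      (principalCongruenceLevel_mono (n + 1) K hne Ideal.mul_le_left (mem_finitePrincipalCongruenceLevel_iff.1 hu))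
  have hf₁U : ∀ u ∈ finitePrincipalCongruenceLevel (n + 1) K (𝔫P * 𝔫Q),
      P.1.toContRep (GLn.ofFinite (n + 1) K u) f₁ = f₁ := fun u hu =>
    TranslateArchValue.toContRep_ofFinite_corestrictW_eq_self hS₁ _ (hKP hu) (e : E)
  have hf₁'U : ∀ u ∈ finitePrincipalCongruenceLevel (n + 1) K (𝔫P * 𝔫Q),
      Q.1.toContRep (GLn.ofFinite (n + 1) K u) f₁' = f₁' := fun u hu =>
    TranslateArchValue.toContRep_ofFinite_corestrictW_eq_self hS₁' _ (hKQ hu) (e' : E')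
  have hf₁fix : ∀ g ∈ principalCongruenceLevel (n + 1) K (𝔫P * 𝔫Q), P.1.toContRep g f₁ = f₁ :=
    toContRep_eq_self_of_forall_ofFinite P.1 hf₁U
  have hf₁'fix : ∀ g ∈ principalCongruenceLevel (n + 1) K (𝔫P * 𝔫Q), Q.1.toContRep g f₁' = f₁' :=
    toContRep_eq_self_of_forall_ofFinite Q.1 hf₁'U
  /- (2) Harish-Chandra's product bump `β` for the pair `(f₁, f₁')` at level `U₀ = K_f(𝔫P 𝔫Q)` -/
  have hU₀o := isOpen_finitePrincipalCongruenceLevel (n + 1) K hne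
  have hU₀c := isCompact_finitePrincipalCongruenceLevel (n + 1) K hne
  obtain ⟨β, hβc, hβs, hβsm, hfixP, hfixQ⟩ :=
    ArchLevelWeightFixingPair.stub_archLevelWeight_fixing_pair hcpt P Q hPQ hU₀o hU₀c f₁ f₁'
      (finiteDimensional_span_corestrictW _ (e : E) hefin) (finiteDimensional_span_corestrictW _ (e' : E') he'fin)
      hf₁U hf₁'U
  /- (3) the spread datum from the initial datum `(𝔫P 𝔫Q, f₁, β)` with `T₀ := S₀`, partner level `𝔫P 𝔫Q` -/
  obtain ⟨T, hS₀T, hTsub, m, hm, 𝔫, h𝔫, h𝔫'dvd, -, hprimes, c, e_, ϖ, L, hL, hnd, hLT, hrad, f, hf, hffix, hβpart⟩ :=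
    SpreadPairDatumOfInitialDatum.stub_spreadPairDatum_of_initialDatum P S₀ (𝔫' := 𝔫P * 𝔫Q) (𝔫₁ := 𝔫P * 𝔫Q)
      hne hne f₁ hf₁fix
  obtain ⟨η, a, rfl, hη, ha, -, hηleft', hsmooth, hblock⟩ := hβpart hβc hβs hβsm
  -- `T = S₀`
  have hTS₀ : T ⊆ S₀ := fun v hv =>
    (hTsub v hv).elim id fun h => hsupp v ((v.prime.dvd_or_dvd h).elim id id)
  obtain rfl : S₀ = T := Finset.Subset.antisymm hS₀T hTS₀
  -- the smoothing scalar of `f`: `S_η f = a f`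
  have hsmoothf : smoothedVector P.1 (archLevelWeight (finitePrincipalCongruenceLevel (n + 1) K 𝔫) β) f = (a : ℂ) • f := by
    rw [hsmooth, hfixP, ← hf]
  /- (4) the partner `f' := f₁'` and its smoothing scalar `a' = c_{K_f 𝔫} / c_{K_f(𝔫P 𝔫Q)}` -/
  have hKo := isOpen_finitePrincipalCongruenceLevel (n + 1) K h𝔫
  have hKc := isCompact_finitePrincipalCongruenceLevel (n + 1) K h𝔫
  have hK𝔫 : finitePrincipalCongruenceLevel (n + 1) K 𝔫 ≤ finitePrincipalCongruenceLevel (n + 1) K (𝔫P * 𝔫Q) :=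
    fun u hu => mem_finitePrincipalCongruenceLevel_iff.2
      (principalCongruenceLevel_mono (n + 1) K h𝔫 (Ideal.le_of_dvd h𝔫'dvd) (mem_finitePrincipalCongruenceLevel_iff.1 hu))
  have hf₁'K𝔫 : ∀ u ∈ finitePrincipalCongruenceLevel (n + 1) K 𝔫, Q.1.toContRep (GLn.ofFinite (n + 1) K u) f₁' = f₁' :=
    fun u hu => hf₁'U u (hK𝔫 hu)
  set c𝔫 : ℝ := (archShadowConst (n := n + 1) (K := K) hKo
    (by rw [((finitePrincipalCongruenceLevel (n + 1) K 𝔫).isClosed_of_isOpen hKo).closure_eq]; exact hKc) : ℝ)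
  set c₁ : ℝ := (archShadowConst (n := n + 1) (K := K) hU₀o
    (by rw [((finitePrincipalCongruenceLevel (n + 1) K (𝔫P * 𝔫Q)).isClosed_of_isOpen hU₀o).closure_eq]; exact hU₀c) : ℝ)
  have hc₁pos : 0 < c₁ := archShadowConst_pos _ hU₀o hU₀c
  have hc𝔫pos : 0 < c𝔫 := archShadowConst_pos _ hKo hKc
  have hsmoothf' : smoothedVector Q.1 (archLevelWeight (finitePrincipalCongruenceLevel (n + 1) K 𝔫) β) f₁' =
      ((c𝔫 * c₁⁻¹ : ℝ) : ℂ) • f₁' := by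
    have h2 := smoothedVector_archLevelWeight_eq_smul_archIntegral (W := Q.1) (β := β) hβc hβs hU₀o hU₀c hf₁'U
    rw [hfixQ] at h2
    rw [smoothedVector_archLevelWeight_eq_smul_archIntegral hβc hβs hKo hKc hf₁'K𝔫]
    conv_rhs => rw [h2]
    rw [smul_smul]
    congr 1
    push_cast
    rw [mul_assoc, inv_mul_cancel₀ (by exact_mod_cast hc₁pos.ne'), mul_one]
  /- (5) the abstract properties of `W = W_{S_η f}` and `W' = W_{S_η f₁'}` -/
  obtain ⟨hWN, hWZ, hWK, -, hWc⟩ :=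
    WhittakerCoeffSmoothedFormProps.stub_whittakerCoeff_smoothedForm_props P ν₀ (𝔫 := 𝔫) (𝔫' := 𝔫) h𝔫 hη f hffix
  obtain ⟨hW'N, -, hW'K, hW'loc, hW'c⟩ :=
    WhittakerCoeffSmoothedFormProps.stub_whittakerCoeff_smoothedForm_props Q ν₀ (𝔫 := 𝔫) (𝔫' := 𝔫P * 𝔫Q) hne hη
      f₁' hf₁'fix
  set W : GL (Fin (n + 1)) (AdeleRing (𝓞 K) K) → ℂ := whittakerCoeff ν₀ (unipotentTateDomain (n + 1) K) (adeleAddChar K)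
    (invQuot (AdelicGroupData.gl (n + 1) K) (smoothedForm (archLevelWeight (finitePrincipalCongruenceLevel (n + 1) K 𝔫) β)
      ((f : P.1.toSubmodule) : (AdelicGroupData.gl (n + 1) K).L2 μ)))
  set W' : GL (Fin (n + 1)) (AdeleRing (𝓞 K) K) → ℂ := whittakerCoeff ν₀ (unipotentTateDomain (n + 1) K) (adeleAddChar K)
    (invQuot (AdelicGroupData.gl (n + 1) K) (smoothedForm (archLevelWeight (finitePrincipalCongruenceLevel (n + 1) K 𝔫) β)
      ((f₁' : Q.1.toSubmodule) : (AdelicGroupData.gl (n + 1) K).L2 μ)))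
  /- (6) support collapse and product form on the unit box -/
  obtain ⟨𝔪, h𝔪, F, hFinv, hF01, hF1, hIF⟩ :=
    UnitBoxTranslateProductForm.stub_unitBox_translate_productForm W W' hWN hW'N hWZ h𝔫 hWK
      (fun u hu g => hW'K u (hK𝔫 hu) g) hprimes hm τ hlast hDS₀
      (fun v hv => by
        obtain ⟨tv, M, c₀, hsp, hψ, hM1, hcnt, hmono, hgap, hdepth⟩ := hblock ν₀ inferInstance v hv
        refine ⟨tv, M, c₀, hsp, hψ, hM1, hmono, hgap, hdepth, fun κ hκ g =>
          hW'loc v κ (valuedCongruenceSubgroup_mono (Fin (n + 1)) ?_ hκ) g⟩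
        rw [idealRadius_eq_exp_neg_natCast v hne, exp_le_exp, neg_le_neg_iff]
        exact hcnt)
      νA νK
  /- (7) the archimedean values of `W`, `W'` at `D (h, 1)` -/
  have hrad₁ : ∀ v ∈ L, exp (-e_ v) ≤ idealRadius K v 𝔫P := fun v hv =>
    (hrad v hv).trans (idealRadius_mono K v (mul_ne_zero hne hne) (Ideal.mul_le_right.trans Ideal.mul_le_right))
  have hDL : ∀ v ∈ L, localComponent v D = 1 := fun v hv => hDS₀ v ((hLT v).1 hv)
  have h𝔞PL : ∀ v ∈ L, ¬ v.asIdeal ∣ ∏ w ∈ S₁₀, w.asIdeal ^ kP w := fun v hv hdvd =>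
    Finset.disjoint_left.1 hdisj ((hLT v).1 hv) (mem_of_dvd_prod_pow kP hdvd)
  have hAval : ∀ h : GL (Fin (n + 1)) (mixedSpace K), W (D * GLn.ofInfinite (n + 1) K h) = (a : ℂ) *
      transferMap (whittakerFunctional ν₀ (continuous_adeleAddChar K) (ContRepresentation.Equiv.refl P.1.toContRep)) hτPc
        (finComponentRep hcpt τP P.1 (GLn.sndHom (n + 1) K D) S₁)
        ⟨τP (toArch hcpt h) (e : E), apply_mem_archGardingSpace hτPc _ e.2⟩ := fun h =>
    TranslateArchValue.stub_translate_arch_value hcpt P hτPc ν₀ h𝔫P S₁ hS₁ e hL hnd hrad₁ D hDL hDinf h𝔞P h𝔞PL hconjP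
      hη f hf hsmoothf h
  have hBval : ∀ h : GL (Fin (n + 1)) (mixedSpace K), W' (D * GLn.ofInfinite (n + 1) K h) = ((c𝔫 * c₁⁻¹ : ℝ) : ℂ) *
      transferMap (whittakerFunctional ν₀ (continuous_adeleAddChar K) (ContRepresentation.Equiv.refl Q.1.toContRep)) hτQc
        (finComponentRep hcpt τQ Q.1 (GLn.sndHom (n + 1) K D) S₁')
        ⟨τQ (toArch hcpt h) (e' : E'), apply_mem_archGardingSpace hτQc _ e'.2⟩ := fun h =>
    TranslateArchValue.stub_translate_arch_value hcpt Q hτQc ν₀ h𝔫Q S₁' hS₁' e' (c := c) (e := e_) (ϖ := ϖ)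
      (L := []) (fun v hv => by simp at hv) List.nodup_nil (fun v hv => by simp at hv) D (fun v hv => by simp at hv)
      hDinf h𝔞Q (fun v hv => by simp at hv) hconjQ hη f₁' rfl hsmoothf' h
  /- (8) coset averaging -/
  set A : GL (Fin (n + 1)) (mixedSpace K) → ℂ := fun h => W (D * GLn.ofInfinite (n + 1) K h)
  set B : GL (Fin (n + 1)) (mixedSpace K) → ℂ := fun h => conj (W' (D * GLn.ofInfinite (n + 1) K h))
  have hA : Continuous A := hWc.comp (continuous_const.mul (GLn.continuous_ofInfinite (n + 1) K))
  have hB : Continuous B :=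
    Complex.continuous_conj.comp (hW'c.comp (continuous_const.mul (GLn.continuous_ofInfinite (n + 1) K)))
  set I : ((Fin (n + 1) → InfiniteAdeleRing K) → ℝ) → ℂ →
      (Fin (n + 1) → ideleGroup K) × ↥(maximalCompactAdelic (n + 1) K) → ℂ :=
    fun Φinf s => torusPairIntegrandC (n + 1) K (fun g => W (D * g)) (fun g => star W' (D * g))
      (thinTestFun (n + 1) K Φinf S₀ m) s
  obtain ⟨r, hr, havg⟩ := UnitBoxTranslateAvg.stub_unitBox_translate_avg hcpt νA νK h𝔪 F hFinv 1 hF01 hF1 A B hA hB I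
    (fun Φinf s p hp => (hIF Φinf s).2 p hp)
  /- (9) the datum -/
  refine ⟨𝔫, h𝔫, hprimes, f, f₁', archLevelWeight (finitePrincipalCongruenceLevel (n + 1) K 𝔫) β, hη, hηleft', m,
    r * a * (c𝔫 * c₁⁻¹), mul_pos (mul_pos hr ha) (mul_pos hc𝔫pos (inv_pos.2 hc₁pos)), fun Φinf hΦ s => ?_⟩
  have h1 : ∫ p in unitBox {v | v ∉ (↑S₀ : Set (HeightOneSpectrum (𝓞 K)))} ×ˢ Set.univ, I Φinf s p ∂(νA.prod νK) =
      ∫ p in unitBox (Set.univ : Set (HeightOneSpectrum (𝓞 K))) ×ˢ Set.univ, I Φinf s p ∂(νA.prod νK) :=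
    (hIF Φinf s).1
  refine h1.trans ((havg Φinf hΦ s).trans ?_)
  rw [archRankinSelbergPairIntegral_def, ← integral_const_mul, ← integral_const_mul]
  refine integral_congr_ae (Eventually.of_forall fun z => ?_)
  beta_reduce
  change (1 * (r : ℂ)) * (W (D * GLn.ofInfinite (n + 1) K _) * conj (W' (D * GLn.ofInfinite (n + 1) K _)) * _ * _) = _
  rw [hAval, hBval, map_mul, Complex.conj_ofReal]
  push_cast
  ring

end Summit.Langlands.Langlands.Theorems.LocalSingleDatum

end
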